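import Mathlib
import HarnessLib
import Literature.MathematicalPhysics.QuantumLattice.GrassmannSupportSplit
import Summits.HubbardSuperconductivity.HubbardSuperconductivity.Theorems.KLProgrammeKLRegimeKernelNormsLevelsDefs

/-!
# Route `KLProgramme` — crux K3 ENGINE (stmt-HubbardSuperconductivity-20437 `KLRegimeEngineV17F2`), stub (b) v2, THE LEVELS PACKAGE (ℓ), read-out (I6)/(I7):
# «(ℓ)-RO5-DEGREE-CAP» — `KernelNormsLevels` at a level `j` from a family of bounds CAPPED IN THE DEGREE, the cap discharged by Grassmann nilpotency
# (cell gate-hubbard-kl, seat p4 g20; located structural remainder «(ℓ)-READOUT-F» of k3c3-p2 g16, piece RO-5 = the per-level closer, p4 lineage)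

The registered clause `KernelNormsLevels L M P Q β U μ K j` (…KernelNormsLevelsDefs) asks the levelled sectorised norm of the scale-`j` action in EVERY even
degree `2p ≥ 6`.  Every row of the floor-keyed chain that feeds it — the law `klTowerBLevF_le_law_lev_of_blocks_Z`, the read-out profile (RO-1), the
partial-block increment (RO-2), the fit (RO-4) — is CAPPED at `p ≤ D` (`card/2 ≤ D`), because the Grassmann steps sum input degrees up to half the number of
generators.  The cap costs nothing at the read-out: the scale-`j` action is an element of the Grassmann algebra on the finitely many labels
`HubbardFieldIdx L M`, so by nilpotency (`kernel_eq_zero_of_card_lt`, Literature/…/GrassmannSupportSplit) every kernel of degree `> card (HubbardFieldIdx L M)`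
vanishes, hence so does every sectorised kernel and every sectorised kernel norm of that degree, for ANY multiplier family and ANY constraint set:
* §1 `sectorisedKernel_eq_zero_of_card_lt`, `hubbardSectorKernelNorm_eq_zero_of_card_lt` (generic), `klAnisoLegKernelNormAt_eq_zero_of_card_lt` (the
  levelled norm of conjunct 2);
* §2 **`kernelNormsLevels_of_capped`** — if `0 ≤ Q.CE`, `0 ≤ P.Klam`, `card (HubbardFieldIdx L M) ≤ 2·D + 1` and the levelled bound holds for `3 ≤ p ≤ D` at
  every prescription, then `KernelNormsLevels L M P Q β U μ K j` (degrees `p > D` have a vanishing left-hand side and a non-negative right-hand side).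
So the RO-5 closer runs the whole chain at ONE cap `D ≥ max (3, ⌈card (HubbardFieldIdx L M)/2⌉, max_k card(SpaceTimeIdx × SectorLeg(sectorCount (dk−1)))/2)`
and never meets a degree above it.  Pure bookkeeping; nothing about the model is asserted; nothing asserts (ℓ), any stub, K3 or superconductivity.
References: BGM 2006 §2.8 (2.76)–(2.77), Lemma 2.5 (2.98) [cite: BenfattoGiulianiMastropietro2006]; Salmhofer 1999 §4.3 (4.95) [cite: Salmhofer1999].
-/

noncomputable section

namespace Summit.HubbardSuperconductivity.HubbardSuperconductivity.Theorems.KLRegimeSplit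

set_option linter.dupNamespace false -- summit = problem name (single-conjunct summit), D-0017

open Classical
open Real Finset Literature.MathematicalPhysics.QuantumLattice Literature.Probability.LatticeModels GrassmannAlgebra
open Summit.HubbardSuperconductivity.HubbardSuperconductivity.Theorems.KLProgrammeLegKernels
open Summit.HubbardSuperconductivity.HubbardSuperconductivity.Theorems.KLRegimeWick

/-! ## §1 Nilpotency: sectorised kernels and their norms vanish above the number of labels -/

section Generic

variable {L M : ℕ} [NeZero L] {N : ℕ}

/-- **Sectorised kernels vanish above the number of Grassmann labels**: for `card (HubbardFieldIdx L M) < m`, every degree-`m` sectorised kernel of every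
Grassmann element is `0` (any multiplier family, any sectors, any positions). [cite: Salmhofer1999, §4.3 (4.95)] -/
theorem sectorisedKernel_eq_zero_of_card_lt (β : ℝ) (F : Fin N → FreqMomentum L M → ℂ) (G : HubbardGrassmann L M) {m : ℕ}
    (hm : Fintype.card (HubbardFieldIdx L M) < m) (Ω : Fin m → SectorLeg N) (x : Fin m → SpaceTimeIdx L M) :
    sectorisedKernel L M β F G m Ω x = 0 := by
  rw [sectorisedKernel_def]
  exact sum_eq_zero fun k _ => by rw [kernel_eq_zero_of_card_lt ℂ G hm, mul_zero]

/-- **… hence every sectorised kernel norm above the number of labels is `0`** (any constraint set, `0 ≤ β`). [cite: BenfattoGiulianiMastropietro2006, §2.8 (2.77)] -/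
theorem hubbardSectorKernelNorm_eq_zero_of_card_lt {β : ℝ} (hβ : 0 ≤ β) (F : Fin N → FreqMomentum L M → ℂ) {m : ℕ}
    (hm : Fintype.card (HubbardFieldIdx L M) < m) (A : Finset (Fin m → SectorLeg N)) (G : HubbardGrassmann L M) :
    hubbardSectorKernelNorm L M β F A G = 0 := by
  obtain ⟨m', rfl⟩ : ∃ m', m = m' + 1 := ⟨m - 1, by omega⟩
  refine le_antisymm ?_ (hubbardSectorKernelNorm_nonneg hβ F A G)
  rw [hubbardSectorKernelNorm]
  refine sectorisedKernelNorm_le_of_forall_le le_rfl fun p s x => ?_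
  rw [sectorLegSum_def]
  refine (sum_eq_zero fun Ω _ => ?_).le
  rw [sum_eq_zero fun X _ => by rw [sectorisedKernel_eq_zero_of_card_lt β F G hm Ω X, norm_zero], mul_zero]

end Generic

section Model

variable {L M : ℕ} [NeZero L]

/-- **The levelled sectorised norm of conjunct 2 vanishes above the number of labels**: `card (HubbardFieldIdx L M) < m` ⇒
`klAnisoLegKernelNormAt L M β U μ K e₀ n m Ωe = 0` for every prescription `Ωe` (`0 ≤ β`). [cite: BenfattoGiulianiMastropietro2006, §2.8 (2.76)-(2.77)] -/
theorem klAnisoLegKernelNormAt_eq_zero_of_card_lt {β : ℝ} (hβ : 0 ≤ β) (U μ : ℝ) (K : TrigPolyC4v) (e₀ : ℝ) (n : ℕ) {m : ℕ}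
    (hm : Fintype.card (HubbardFieldIdx L M) < m) (Ωe : Fin m → Option (SectorLeg (sectorCount n))) :
    klAnisoLegKernelNormAt L M β U μ K e₀ n m Ωe = 0 := by
  unfold klAnisoLegKernelNormAt
  exact hubbardSectorKernelNorm_eq_zero_of_card_lt hβ _ hm _ _

/-! ## §2 `KernelNormsLevels` from a degree-capped family of bounds -/

/-- **`KernelNormsLevels` FROM A CAPPED FAMILY OF LEVELLED BOUNDS** («(ℓ)-RO5-DEGREE-CAP»): if `0 ≤ Q.CE`, `0 ≤ P.Klam`, the cap `D` satisfies
`card (HubbardFieldIdx L M) ≤ 2·D + 1`, and the levelled bound `klAnisoLegKernelNormAt … j (2p) Ωe ≤ CE^p·ε_j^{p−1}·2^{(3p−5)j}·(2^{−j})^{levelGainExp F(Ωe)}`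
holds for every `3 ≤ p ≤ D` and every prescription `Ωe`, then `KernelNormsLevels L M P Q β U μ K j`: in degrees `p > D` the left-hand side vanishes by
nilpotency and the right-hand side is non-negative. [cite: BenfattoGiulianiMastropietro2006, Lemma 2.5 (2.98)] -/
theorem kernelNormsLevels_of_capped {β : ℝ} (hβ : 0 ≤ β) {U μ : ℝ} {K : TrigPolyC4v} {j : ℕ} {P : SplitConsts} {Q : EngConsts}
    (hCE : 0 ≤ Q.CE) (hK : 0 ≤ P.Klam) {D : ℕ} (hD : Fintype.card (HubbardFieldIdx L M) ≤ 2 * D + 1)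
    (h : ∀ p : ℕ, 3 ≤ p → p ≤ D → ∀ Ωe : Fin (2 * p) → Option (SectorLeg (sectorCount j)),
      klAnisoLegKernelNormAt L M β U μ K klE0 j (2 * p) Ωe ≤
        Q.CE ^ p * (epsCoupling P U j) ^ (p - 1) * (2 : ℝ) ^ ((3 * (p : ℤ) - 5) * j) * (((2 : ℝ) ^ j)⁻¹) ^ levelGainExp (levelCount Ωe)) :
    KernelNormsLevels L M P Q β U μ K j := by
  intro p hp Ωe
  by_cases hpD : p ≤ D
  · exact h p hp hpD Ωe
  · rw [klAnisoLegKernelNormAt_eq_zero_of_card_lt hβ U μ K klE0 j (by omega) Ωe]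
    have hε : 0 ≤ epsCoupling P U j := by unfold epsCoupling; positivity
    positivity

end Model

end Summit.HubbardSuperconductivity.HubbardSuperconductivity.Theorems.KLRegimeSplit

end
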